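import Summits.CriticalPhenomena.CardyFormulaZ2.Theorems.CardyWickAnisotropyBoxFamilyToCardyStubZ2BoxesToRectCardyPart3
import HarnessLib

/-!
# `stub_z2BoxesToRectCardy`, part 4: the discretisation sandwich — the limit `δ → 0⁺`

Support file for line `birth` of crux `BoxFamilyToCardy` (stmt-CriticalPhenomena-14215), stub
`stub_z2BoxesToRectCardy`. Proves the statement of the sibling line's `RectValue … stub_boxSandwich`
(`Cruxes/RectValue/Lines/birth.lean`, crux stmt-CriticalPhenomena-5845) as the theorem
`rect_boxSandwich` (registered sub-goal of this file):

for `P` continuous on `(0,∞)` interpolating the lattice limits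
`crossingProb half (p m) (q m − 1) → P (p/q)` (`p, q ≥ 1`), the left–right crossing probability of
the G02-discretised open box `(0,w)×(0,h)` (closed vertical sides as arcs) tends to `P (w/h)` as the
mesh `δ → 0⁺`.

Proof: part 3 (`box_sandwich`) squeezes the crossing probability at mesh `δ` between
`crossingProb half M (N−1)` and `crossingProb half M N`, where `δ(M+1) < w ≤ δ(M+2)` and
`δ(N+1) < h ≤ δ(N+2)` (`exists_nat_window`); monotonicity of `crossingProb` in the two dimensions
(`crossingProb_anti_left`, `crossingProb_mono_right`, tree `RSW.lean`) compares these with members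
`(p m, q m − 1)` of the family for rationals `p/q` on either side of `w/h`
(`exists_nat_ratio_btwn`), and continuity of `P` at `w/h` closes the sandwich (`tendsto_order`).
No definitions are introduced.

References: S. Smirnov, C. R. Acad. Sci. Paris 333 (2001) 239, §2 [Smirnov2001];
B. Bollobás, O. Riordan, *Percolation* (2006), Ch. 3 [BollobasRiordan2006].
-/

noncomputable section

namespace Summit.CriticalPhenomena.CardyFormulaZ2.Cruxes.BoxFamilyToCardy.Birth

open Set Filter Topology
open Literature.Probability.Percolation

namespace RectLattice

/-- Bookkeeping for the lower bound: with `k = M / p` (`k p ≤ M < k p + p`), the family member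
`(p (k+1), q (k+1) − 1)` is wider and shorter than `[0,M]×[0,N−1]` and has a large index, once the mesh
is below the two explicit thresholds. [folklore] -/
theorem lower_arith {δ w h : ℝ} {p q M N k M₀ : ℕ} (hδ : 0 < δ) (hp : 1 ≤ p) (hq : 1 ≤ q)
    (hM1 : δ * (M + 1) < w) (hM2 : w ≤ δ * (M + 2)) (hN2 : h ≤ δ * (N + 2))
    (hk1 : k * p ≤ M) (hk2 : M < k * p + p)
    (hδ1 : δ * (p * (q + 2)) ≤ p * h - q * w) (hδ2 : δ * (p * M₀ + 2) ≤ w) :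
    M ≤ p * (k + 1) ∧ q * (k + 1) ≤ N ∧ M₀ ≤ k + 1 := by
  have hqr : (0 : ℝ) < q := by exact_mod_cast hq
  have hpr : (0 : ℝ) < p := by exact_mod_cast hp
  have hk1r : (k : ℝ) * p ≤ M := by exact_mod_cast hk1
  have hk2r : (M : ℝ) < k * p + p := by exact_mod_cast hk2
  refine ⟨?_, ?_, ?_⟩
  · have : M < p * (k + 1) := by
      calc M < k * p + p := hk2
        _ = p * (k + 1) := by ring
    exact this.le
  · -- `q (k + 1) ≤ N`
    have e1 : (p : ℝ) * (q * (k + 1)) ≤ q * M + p * q := by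
      have := mul_le_mul_of_nonneg_left hk1r hqr.le
      linarith
    have e2 : δ * (q * M + p * q) < q * w + δ * q * (p - 1) := by
      have := mul_lt_mul_of_pos_left hM1 hqr
      linarith
    have e3 : q * w + δ * q * (p - 1) ≤ p * h - 2 * p * δ := by
      have := mul_nonneg hδ.le hqr.le
      linarith
    have e4 : p * h - 2 * p * δ ≤ p * (δ * N) := by
      have := mul_le_mul_of_nonneg_left hN2 hpr.le
      linarith
    have e5 : δ * p * (q * (k + 1)) < δ * p * N := by
      have := mul_le_mul_of_nonneg_left e1 hδ.le
      linarith
    have e6 : (q : ℝ) * (k + 1) < N := lt_of_mul_lt_mul_left e5 (by positivity)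
    have : ((q * (k + 1) : ℕ) : ℝ) < N := by push_cast; exact e6
    exact_mod_cast this.le
  · -- `M₀ ≤ k + 1`
    have h3 : δ * M < δ * (k * p + p) := mul_lt_mul_of_pos_left hk2r hδ
    have h4 : δ * (p * M₀) < δ * (p * (k + 1)) := by linarith
    have e7 : (p : ℝ) * M₀ < p * (k + 1) := lt_of_mul_lt_mul_left h4 hδ.le
    have : (M₀ : ℝ) < k + 1 := lt_of_mul_lt_mul_left e7 hpr.le
    have : M₀ < k + 1 := by exact_mod_cast this
    omega

/-- Bookkeeping for the upper bound: with `k = M / p`, the family member `(p k, q k − 1)` is narrower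
and taller than `[0,M]×[0,N]` and has a large index, once the mesh is below the two explicit
thresholds. [folklore] -/
theorem upper_arith {δ w h : ℝ} {p q M N k M₀ : ℕ} (hδ : 0 < δ) (hp : 1 ≤ p) (hq : 1 ≤ q)
    (hM2 : w ≤ δ * (M + 2)) (hN1 : δ * (N + 1) < h)
    (hk1 : k * p ≤ M) (hk2 : M < k * p + p)
    (hδ1 : δ * (q * (p + 2)) ≤ q * w - p * h) (hδ2 : δ * (p * M₀ + p + 2) ≤ w) :
    p * k ≤ M ∧ N ≤ q * k - 1 ∧ M₀ ≤ k := by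
  have hqr : (0 : ℝ) < q := by exact_mod_cast hq
  have hpr : (0 : ℝ) < p := by exact_mod_cast hp
  have hk2r : (M : ℝ) < k * p + p := by exact_mod_cast hk2
  have h3 : δ * M < δ * (k * p + p) := mul_lt_mul_of_pos_left hk2r hδ
  refine ⟨?_, ?_, ?_⟩
  · calc p * k = k * p := Nat.mul_comm _ _
      _ ≤ M := hk1
  · -- `N + 1 < q k`
    have e1 : δ * (p * (N + 1)) < p * h := by
      have := mul_lt_mul_of_pos_left hN1 hpr
      linarith
    have e3 : (q : ℝ) * w - δ * q * (p + 2) < δ * (p * (q * k)) := by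
      have h4 : (q : ℝ) * (w - 2 * δ - δ * p) < q * (δ * (k * p)) :=
        mul_lt_mul_of_pos_left (by linarith) hqr
      linarith
    have e4 : δ * (p * (N + 1)) < δ * (p * (q * k)) := by linarith
    have e5 : (p : ℝ) * (N + 1) < p * (q * k) := lt_of_mul_lt_mul_left e4 hδ.le
    have e6 : ((N : ℝ) + 1) < q * k := lt_of_mul_lt_mul_left e5 hpr.le
    have h7 : N + 1 < q * k := by exact_mod_cast e6
    exact Nat.le_sub_one_of_lt (lt_of_le_of_lt (Nat.le_succ N) h7)
  · -- `M₀ ≤ k`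
    have h4 : δ * (p * M₀) < δ * (p * k) := by linarith
    have e7 : (p : ℝ) * M₀ < p * k := lt_of_mul_lt_mul_left h4 hδ.le
    have : (M₀ : ℝ) < k := lt_of_mul_lt_mul_left e7 hpr.le
    have : M₀ < k := by exact_mod_cast this
    omega

end RectLattice

open RectLattice in
/-- **The discretisation sandwich for boxes** (the statement of the sibling line's
`RectValue … stub_boxSandwich`, proved): for `P` continuous on `(0,∞)` interpolating the lattice
limits `crossingProb half (p m) (q m − 1) → P(p/q)`, the left–right crossing probability of the
G02-discretised open box `(0,w)×(0,h)` (closed vertical sides as arcs) tends to `P (w/h)` as the mesh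
`δ → 0⁺`. [folklore] -/
theorem rect_boxSandwich : ∀ P : ℝ → ℝ, ContinuousOn P (Set.Ioi 0) →
    (∀ p q : ℕ, 1 ≤ p → 1 ≤ q → Filter.Tendsto
      (fun m : ℕ ↦ Literature.Probability.Percolation.crossingProb Literature.Probability.Percolation.half
        (p * m) (q * m - 1)) Filter.atTop (nhds (P ((p : ℝ) / (q : ℝ))))) →
    ∀ w h : ℝ, 0 < w → 0 < h → Filter.Tendsto (fun δ : ℝ ↦
      Literature.Probability.Percolation.discreteCrossingProb Literature.Probability.Percolation.half
        (Set.Ioo (0:ℝ) w ×ℂ Set.Ioo (0:ℝ) h) δ {z : ℂ | z.re = 0 ∧ 0 ≤ z.im ∧ z.im ≤ h}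
        {z : ℂ | z.re = w ∧ 0 ≤ z.im ∧ z.im ≤ h}) (nhdsWithin 0 (Set.Ioi 0)) (nhds (P (w / h))) := by
  intro P hP hfam w h hw hh
  have hr : 0 < w / h := div_pos hw hh
  have hPc : ContinuousAt P (w / h) := (hP _ hr).continuousAt (isOpen_Ioi.mem_nhds hr)
  rw [tendsto_order]
  constructor
  · -- LOWER BOUND: `a < P (w/h)` ⟹ eventually `a <` the crossing probability
    intro a ha
    -- a rational aspect ratio `p/q > w/h` with `a < P (p/q)`
    have hev : ∀ᶠ s in 𝓝 (w / h), a < P s := hPc.eventually_const_lt ha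
    obtain ⟨ε, hε, hball⟩ := Metric.eventually_nhds_iff.1 hev
    obtain ⟨p, q, hp, hq, hlo, hhi⟩ :=
      exists_nat_ratio_btwn hr.le (show w / h < w / h + ε by linarith)
    have hPa : a < P (p / q) := hball (by rw [Real.dist_eq, abs_lt]; constructor <;> linarith)
    obtain ⟨M₀, hM₀⟩ := eventually_atTop.1 ((hfam p q hp hq).eventually_const_lt hPa)
    have hqr : (0 : ℝ) < q := by exact_mod_cast hq
    have hpr : (0 : ℝ) < p := by exact_mod_cast hp
    have hgap : 0 < p * h - q * w := by
      have := hlo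
      rw [div_lt_div_iff₀ hh hqr] at this
      linarith
    -- the mesh threshold
    set δ₀ : ℝ := min (min (w / 3) (h / 3)) (min ((p * h - q * w) / (p * (q + 2))) (w / (p * M₀ + 2)))
      with hδ₀
    have hδ₀pos : 0 < δ₀ :=
      lt_min (lt_min (by positivity) (by positivity))
        (lt_min (div_pos hgap (by positivity)) (div_pos hw (by positivity)))
    filter_upwards [Ioo_mem_nhdsGT hδ₀pos] with δ hδI
    obtain ⟨hδ, hδlt⟩ := hδI
    have hδw : δ < w / 3 := hδlt.trans_le ((min_le_left _ _).trans (min_le_left _ _))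
    have hδh : δ < h / 3 := hδlt.trans_le ((min_le_left _ _).trans (min_le_right _ _))
    have hδ1 : δ ≤ (p * h - q * w) / (p * (q + 2)) :=
      hδlt.le.trans ((min_le_right _ _).trans (min_le_left _ _))
    have hδ2 : δ ≤ w / (p * M₀ + 2) := hδlt.le.trans ((min_le_right _ _).trans (min_le_right _ _))
    rw [le_div_iff₀ (by positivity)] at hδ1
    rw [le_div_iff₀ (by positivity)] at hδ2
    -- the lattice window and the sandwich
    obtain ⟨M, hM, hM1, hM2⟩ := exists_nat_window hδ (by linarith : 2 * δ < w)
    obtain ⟨N, hN, hN1, hN2⟩ := exists_nat_window hδ (by linarith : 2 * δ < h)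
    have hsand := (box_sandwich hw hh hδ hM hN hM1 hM2 hN1 hN2).1
    -- the family member `(p m, q m - 1)` with `m = M / p + 1`
    obtain ⟨k, hk⟩ : ∃ k : ℕ, k = M / p := ⟨_, rfl⟩
    have hk1 : k * p ≤ M := hk ▸ Nat.div_mul_le_self M p
    have hk2 : M < k * p + p := hk ▸ Nat.lt_div_mul_add hp
    obtain ⟨hpm, hqm, hm₀⟩ := lower_arith hδ hp hq hM1 hM2 hN2 hk1 hk2 hδ1 hδ2
    calc a < crossingProb half (p * (k + 1)) (q * (k + 1) - 1) := hM₀ (k + 1) hm₀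
      _ ≤ crossingProb half (p * (k + 1)) (N - 1) :=
          crossingProb_mono_right _ _ (Nat.sub_le_sub_right hqm 1)
      _ ≤ crossingProb half M (N - 1) := crossingProb_anti_left _ hpm _
      _ ≤ _ := hsand
  · -- UPPER BOUND: `P (w/h) < a` ⟹ eventually the crossing probability `< a`
    intro a ha
    -- a rational aspect ratio `p/q < w/h` with `P (p/q) < a`
    have hev : ∀ᶠ s in 𝓝 (w / h), P s < a := hPc.eventually_lt_const ha
    obtain ⟨ε, hε, hball⟩ := Metric.eventually_nhds_iff.1 hev
    set ε' : ℝ := min ε (w / h / 2) with hε'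
    have hε'pos : 0 < ε' := lt_min hε (by positivity)
    have hε'1 : ε' ≤ ε := min_le_left _ _
    have hε'2 : ε' ≤ w / h / 2 := min_le_right _ _
    obtain ⟨p, q, hp, hq, hlo, hhi⟩ :=
      exists_nat_ratio_btwn (show 0 ≤ w / h - ε' by linarith) (show w / h - ε' < w / h by linarith)
    have hPa : P (p / q) < a := hball (by rw [Real.dist_eq, abs_lt]; constructor <;> linarith)
    obtain ⟨M₀, hM₀⟩ := eventually_atTop.1 ((hfam p q hp hq).eventually_lt_const hPa)
    have hqr : (0 : ℝ) < q := by exact_mod_cast hq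
    have hpr : (0 : ℝ) < p := by exact_mod_cast hp
    have hgap : 0 < q * w - p * h := by
      have := hhi
      rw [div_lt_div_iff₀ hqr hh] at this
      linarith
    -- the mesh threshold
    set δ₀ : ℝ := min (min (w / 3) (h / 3)) (min ((q * w - p * h) / (q * (p + 2))) (w / (p * M₀ + p + 2)))
      with hδ₀
    have hδ₀pos : 0 < δ₀ :=
      lt_min (lt_min (by positivity) (by positivity))
        (lt_min (div_pos hgap (by positivity)) (div_pos hw (by positivity)))
    filter_upwards [Ioo_mem_nhdsGT hδ₀pos] with δ hδI
    obtain ⟨hδ, hδlt⟩ := hδI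
    have hδw : δ < w / 3 := hδlt.trans_le ((min_le_left _ _).trans (min_le_left _ _))
    have hδh : δ < h / 3 := hδlt.trans_le ((min_le_left _ _).trans (min_le_right _ _))
    have hδ1 : δ ≤ (q * w - p * h) / (q * (p + 2)) :=
      hδlt.le.trans ((min_le_right _ _).trans (min_le_left _ _))
    have hδ2 : δ ≤ w / (p * M₀ + p + 2) :=
      hδlt.le.trans ((min_le_right _ _).trans (min_le_right _ _))
    rw [le_div_iff₀ (by positivity)] at hδ1
    rw [le_div_iff₀ (by positivity)] at hδ2
    -- the lattice window and the sandwich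
    obtain ⟨M, hM, hM1, hM2⟩ := exists_nat_window hδ (by linarith : 2 * δ < w)
    obtain ⟨N, hN, hN1, hN2⟩ := exists_nat_window hδ (by linarith : 2 * δ < h)
    have hsand := (box_sandwich hw hh hδ hM hN hM1 hM2 hN1 hN2).2
    -- the family member `(p k, q k - 1)` with `k = M / p`
    obtain ⟨k, hk⟩ : ∃ k : ℕ, k = M / p := ⟨_, rfl⟩
    have hk1 : k * p ≤ M := hk ▸ Nat.div_mul_le_self M p
    have hk2 : M < k * p + p := hk ▸ Nat.lt_div_mul_add hp
    obtain ⟨hpm, hqm, hm₀⟩ := upper_arith hδ hp hq hM2 hN1 hk1 hk2 hδ1 hδ2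
    calc _ ≤ crossingProb half M N := hsand
      _ ≤ crossingProb half (p * k) N := crossingProb_anti_left _ hpm _
      _ ≤ crossingProb half (p * k) (q * k - 1) := crossingProb_mono_right _ _ hqm
      _ < a := hM₀ k hm₀

end Summit.CriticalPhenomena.CardyFormulaZ2.Cruxes.BoxFamilyToCardy.Birth

end
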